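import Summits.ResolutionOfSingularities.ResolutionOfSingularities.Theorems.CornerTowerDynamicsTwo
import Summits.ResolutionOfSingularities.ResolutionOfSingularities.Theorems.CornerTowerDynamicsThree
import Summits.ResolutionOfSingularities.ResolutionOfSingularities.Theorems.HugDimensionClasses
import Summits.ResolutionOfSingularities.ResolutionOfSingularities.Theorems.CornerTowerDescent
import HarnessLib

/-!
# CornerTowerDynamics — the tree leaf `NoCornerTower 4 n` and lens-4's `HugDimensionClasses.NoCornerTowers`
(`∀ n ≥ 1, ∀ d ≤ 4, NoCornerTower d n`) PROVED BY NAME, port-free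
(decomp-res node «ProximityCut» rev 3, lens-3 g12, sha256 e1d6297007058045; CRITIC-LEDGER row 84 CLEARED-REV3,
filing order (W5);
co-credit lens-5 g13 `Theorems/CornerTowerDescent`, row 82)

[WRITER NOTE (decomp-res writer g5).  Third W5 module: lens §7 VERBATIM (docstring :1748–:1765, `cOff` +
`namespace CornerTowerDyn` :1767–:2057, `noCornerTower_four` :2115–:2168) in namespace
`…Theorems.CornerTowerDynamics` (`dyn_eventually` / `dyn3_eventually` / `fin3_pair` are the landed parts
Two/Three); lens `apply_add_apply_le_deg` is cited as the landed `CornerTowerDescent.expo_add_le_deg` (same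
statement); lens `fin2_other` / `noCornerTower_two` / `_three` / `noCornerTowers_holds` are NOT filed (critic row
84: `d ≤ 3` is the landed `CornerTowerDescent.noCornerTower_two` / `_three` / `_le_three`; ONE declaration
concludes the leaf): `noCornerTowers_tree : HugDimensionClasses.NoCornerTowers` = `noCornerTower_four` glued to `d
≤ 3` by `CornerTowerDescent.noCornerTower_le_four_of_four`.  Row 84: the KNOWN-MOD-PORT booking of leaf #17′
(`noCornerTowers_of_model`) is RETIRED; `hC` / `hK : NoCornerTowers` of `MaxContactCutHugDimension` /
`MaxContactCutSurfaceShadow` are discharged by `noCornerTowers_tree`.  0 sorry; support definitions `cOff`,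
`CornerTowerDyn.cdesc`.] (Sources: BierstoneGrigorievMilmanWlodarczyk2011, §3; Hauser2010 Lecture IX.)
-/

namespace Summit.ResolutionOfSingularities.ResolutionOfSingularities.Theorems.CornerTowerDynamics
open Summit.ResolutionOfSingularities.ResolutionOfSingularities.Theorems
/-! ## §7 THE TREE'S LEAF `NoCornerTower d n` (`d ≤ 4`) AND lens-4's `NoCornerTowers` — PROVED IN LEAN
(g12 addendum; `d = 2, 3` in rev 2, `d = 4` and the piece BY NAME in rev 3)

Cheap theorem #17′ of critic row 58, booked on MaxContactCut 31569 as «`NoCornerTower d n` KNOWN mod `CornerModel` +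
`TowerObstructs`, ATTACKABLE directly; `d ≤ 1` proved»: the SAME Euclid dynamics in lens-4's monomial corner-tower
model (`MonomialTowerClasses.CornerTower`: exponent sets of order exactly `n`, corner isolated, chart images — no
cleaning, every lineage alive).  Exhaustive towers: the tree's `CornerTower.not_exhaustive`.  A dead direction `k`
from stage `i₀`: for `d = 2` the live direction is then constant and the thin-off-it isolation witness descends in
degree (`ct_no_thin_const`); for `d = 3` either one live direction is eventually constant (same descent) or both
recur: doubly thin generators descend (`ct_no_doubly_thin`), so along every lineage `(y_{a'}, y_a)` is never doubly
negative and `dyn_eventually` fattens it off `a`; pigeonhole over the finite `G i₀` gives a stage with every generator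
fat off `a`, contradicting `isolated`.  RESULT: `noCornerTower_two`, `noCornerTower_three` (all `n`; port-free), so
`noCornerTower_four` (rev 3: a second dead direction ⇒ `not_two_live` on the two remaining ones; else the three live
directions `k.succAbove z` all recur ⇒ triply thin generators descend, `no_triply_thin'`, every lineage fattens in
every live direction by the THREE-LETTER dynamics `dyn3_eventually` of §6b, `lineage_fat3`, pigeonhole,
`not_three_live`), hence lens-4's `HugDimensionClasses.NoCornerTowers` BY NAME (`noCornerTowers_tree`). -/

section CornerTowers
open Summit.ResolutionOfSingularities.ResolutionOfSingularities.Theorems.MonomialTowerClasses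
variable {d n : ℕ}

/-- Off-`l` degree in the corner model.  DEFINITION (support). -/
def cOff (l : Fin d) (α : Expo d) : ℕ := α.deg - α l

/-- A step in direction `j` keeps the off-`j` degree … [folklore] -/
theorem cOff_chart_self (n : ℕ) (j : Fin d) (α : Expo d) : cOff j (Expo.chart n j α) = cOff j α := by
  unfold cOff
  rw [Expo.deg_chart, Expo.chart_apply_same]
  omega

/-- … adds `y_j` to `y_l` (`l ≠ j`) … [folklore] -/
theorem cOff_chart_of_ne (n : ℕ) {j l : Fin d} (hlj : l ≠ j) (α : Expo d) (h : n ≤ α.deg) :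
    cOff l (Expo.chart n j α) + n = cOff l α + cOff j α := by
  unfold cOff
  rw [Expo.deg_chart, Expo.chart_apply_ne n hlj]
  have h1 := CornerTowerDescent.expo_add_le_deg α hlj
  omega

/-- … and changes the degree by `y_j`. [folklore] -/
theorem deg_chart_add (n : ℕ) (j : Fin d) (α : Expo d) (h : n ≤ α.deg) :
    (Expo.chart n j α).deg + n = α.deg + cOff j α := by
  unfold cOff
  rw [Expo.deg_chart]
  have := Expo.le_deg α j
  omega

/-- An exponent is bounded by every off-degree not excluding it. [folklore] -/
theorem apply_le_cOff {x y : Fin d} (hxy : x ≠ y) (α : Expo d) : α x ≤ cOff y α := by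
  unfold cOff
  have := CornerTowerDescent.expo_add_le_deg α hxy
  omega

namespace CornerTowerDyn

variable (T : CornerTower d n)

/-- Every generator of the next stage has a parent. [folklore] -/
theorem exists_parent' {i : ℕ} {β : Expo d} (h : β ∈ T.G (i + 1)) : ∃ α ∈ T.G i, Expo.chart n (T.dir i) α = β := by
  rw [T.step i, Finset.mem_image] at h
  exact h

/-- **AXIS DESCENT (PROVED):** with the direction constant `= j` from stage `i₀`, no generator is thin off `j`. [folklore] -/
theorem no_thin_const {i₀ : ℕ} {j : Fin d} (hdir : ∀ i, i₀ ≤ i → T.dir i = j) :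
    ∀ M i : ℕ, i₀ ≤ i → ∀ α ∈ T.G i, cOff j α < n → α.deg ≤ M → False := by
  intro M
  induction M with
  | zero =>
    intro i hi α hα hthin hM
    have := (T.hasOrder i).2 α hα
    omega
  | succ M ih =>
    intro i hi α hα hthin hM
    have hdeg := (T.hasOrder i).2 α hα
    have hmem := T.chart_mem hα
    rw [hdir i hi] at hmem
    have e1 := cOff_chart_self n j α
    have e2 := deg_chart_add n j α hdeg
    exact ih (i + 1) (by omega) _ hmem (by omega) (by omega)

/-- The axis case: a constant direction contradicts isolation at once. [folklore] -/
theorem not_const {i₀ : ℕ} {j : Fin d} (hdir : ∀ i, i₀ ≤ i → T.dir i = j) : False := by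
  obtain ⟨α, hα, hthin⟩ := T.isolated i₀ j
  exact no_thin_const T hdir α.deg i₀ le_rfl α hα hthin le_rfl

/-- **DOUBLY THIN DESCENT (PROVED):** with live directions in `{a, a'}` from `i₀`, no generator is thin off both.
[folklore] -/
theorem no_doubly_thin' {i₀ : ℕ} {a a' : Fin d} (haa' : a ≠ a')
    (hlive : ∀ i, i₀ ≤ i → T.dir i = a ∨ T.dir i = a') :
    ∀ M i : ℕ, i₀ ≤ i → ∀ α ∈ T.G i, cOff a α < n → cOff a' α < n → α.deg ≤ M → False := by
  have step : ∀ i, ∀ {b b' : Fin d}, b ≠ b' → T.dir i = b → ∀ α ∈ T.G i, cOff b α < n → cOff b' α < n →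
      Expo.chart n b α ∈ T.G (i + 1) ∧ cOff b (Expo.chart n b α) < n ∧ cOff b' (Expo.chart n b α) < n ∧
        (Expo.chart n b α).deg < α.deg := by
    intro i b b' hbb' hdb α hα h1 h2
    have hdeg := (T.hasOrder i).2 α hα
    have hmem := T.chart_mem hα
    rw [hdb] at hmem
    have e1 := cOff_chart_self n b α
    have e2 := cOff_chart_of_ne n (Ne.symm hbb') α hdeg
    have e3 := deg_chart_add n b α hdeg
    exact ⟨hmem, by omega, by omega, by omega⟩
  intro M
  induction M with
  | zero =>
    intro i hi α hα h1 h2 hM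
    have := (T.hasOrder i).2 α hα
    omega
  | succ M ih =>
    intro i hi α hα h1 h2 hM
    rcases hlive i hi with hd | hd
    · obtain ⟨hmem, g1, g2, glt⟩ := step i haa' hd α hα h1 h2
      exact ih (i + 1) (by omega) _ hmem g1 g2 (by omega)
    · obtain ⟨hmem, g1, g2, glt⟩ := step i (Ne.symm haa') hd α hα h2 h1
      exact ih (i + 1) (by omega) _ hmem g2 g1 (by omega)

/-- The lineage of a generator from stage `i₀`.  DEFINITION (support). -/
def cdesc (i₀ : ℕ) (α₀ : Expo d) : ℕ → Expo d
  | 0 => α₀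
  | m + 1 => Expo.chart n (T.dir (i₀ + m)) (cdesc i₀ α₀ m)

/-- Lineages stay alive. [folklore] -/
theorem cdesc_mem {i₀ : ℕ} {α₀ : Expo d} (h : α₀ ∈ T.G i₀) : ∀ m, cdesc T i₀ α₀ m ∈ T.G (i₀ + m) := by
  intro m
  induction m with
  | zero => exact h
  | succ m ih => exact T.chart_mem ih

/-- Every generator descends from stage `i₀`. [folklore] -/
theorem exists_ancestor' (i₀ : ℕ) : ∀ m, ∀ β ∈ T.G (i₀ + m), ∃ α₀ ∈ T.G i₀, cdesc T i₀ α₀ m = β := by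
  intro m
  induction m with
  | zero => exact fun β hβ => ⟨β, hβ, rfl⟩
  | succ m ih =>
    intro β hβ
    obtain ⟨α₁, hα₁, he⟩ := exists_parent' T (i := i₀ + m) hβ
    obtain ⟨α₀, hα₀, hdesc⟩ := ih α₁ hα₁
    refine ⟨α₀, hα₀, ?_⟩
    show Expo.chart n (T.dir (i₀ + m)) (cdesc T i₀ α₀ m) = β
    rw [hdesc]
    exact he

/-- **LINEAGE FATTENING (PROVED):** two recurring live directions fatten every lineage off `a`. [folklore] -/
theorem lineage_fat {i₀ : ℕ} {a a' : Fin d} (haa' : a ≠ a') (hlive : ∀ i, i₀ ≤ i → T.dir i = a ∨ T.dir i = a')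
    (hLio : ∀ m, ∃ m', m ≤ m' ∧ T.dir (i₀ + m') = a) (hRio : ∀ m, ∃ m', m ≤ m' ∧ T.dir (i₀ + m') = a')
    {α₀ : Expo d} (hα₀ : α₀ ∈ T.G i₀) : ∃ m₀, ∀ m, m₀ ≤ m → n ≤ cOff a (cdesc T i₀ α₀ m) := by
  classical
  let x : ℕ → ℤ := fun m => (cOff a' (cdesc T i₀ α₀ m) : ℤ) - n
  let y : ℕ → ℤ := fun m => (cOff a (cdesc T i₀ α₀ m) : ℤ) - n
  have halive := cdesc_mem T hα₀
  have hdeg : ∀ m, n ≤ (cdesc T i₀ α₀ m).deg := fun m => (T.hasOrder _).2 _ (halive m)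
  have hL : ∀ m, T.dir (i₀ + m) = a → x (m + 1) = x m + y m ∧ y (m + 1) = y m := by
    intro m hm
    have e1 := cOff_chart_of_ne n (Ne.symm haa') (cdesc T i₀ α₀ m) (hdeg m)
    have e2 := cOff_chart_self n a (cdesc T i₀ α₀ m)
    have hd : cdesc T i₀ α₀ (m + 1) = Expo.chart n a (cdesc T i₀ α₀ m) := by
      show Expo.chart n (T.dir (i₀ + m)) (cdesc T i₀ α₀ m) = _
      rw [hm]
    simp only [x, y, hd]
    constructor <;> omega
  have hR : ∀ m, ¬ T.dir (i₀ + m) = a → x (m + 1) = x m ∧ y (m + 1) = x m + y m := by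
    intro m hm
    have hm' : T.dir (i₀ + m) = a' := (hlive _ (by omega)).resolve_left hm
    have e1 := cOff_chart_of_ne n haa' (cdesc T i₀ α₀ m) (hdeg m)
    have e2 := cOff_chart_self n a' (cdesc T i₀ α₀ m)
    have hd : cdesc T i₀ α₀ (m + 1) = Expo.chart n a' (cdesc T i₀ α₀ m) := by
      show Expo.chart n (T.dir (i₀ + m)) (cdesc T i₀ α₀ m) = _
      rw [hm']
    simp only [x, y, hd]
    constructor <;> omega
  have hH : ∀ m, ¬ (x m < 0 ∧ y m < 0) := by
    intro m ⟨hx, hy⟩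
    have hx' : cOff a' (cdesc T i₀ α₀ m) < n := by simp only [x] at hx; omega
    have hy' : cOff a (cdesc T i₀ α₀ m) < n := by simp only [y] at hy; omega
    exact no_doubly_thin' T haa' hlive _ (i₀ + m) (by omega) _ (halive m) hy' hx' le_rfl
  have hRio' : ∀ m, ∃ m', m ≤ m' ∧ ¬ T.dir (i₀ + m') = a := by
    intro m
    obtain ⟨m', hm', hdm⟩ := hRio m
    exact ⟨m', hm', by rw [hdm]; exact Ne.symm haa'⟩
  obtain ⟨m₀, hm₀⟩ := dyn_eventually x y (fun m => T.dir (i₀ + m) = a) hL hR hH hLio hRio'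
  refine ⟨m₀, fun m hm => ?_⟩
  have := (hm₀ m hm).2
  simp only [y] at this
  omega

/-- **TWO RECURRING LIVE DIRECTIONS (PROVED):** pigeonhole over `G i₀` + lineage fattening contradict `isolated`.
[folklore] -/
theorem not_two_live {i₀ : ℕ} {a a' : Fin d} (haa' : a ≠ a') (hlive : ∀ i, i₀ ≤ i → T.dir i = a ∨ T.dir i = a')
    (hLio : ∀ m, ∃ m', m ≤ m' ∧ T.dir (i₀ + m') = a) (hRio : ∀ m, ∃ m', m ≤ m' ∧ T.dir (i₀ + m') = a') :
    False := by
  classical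
  have hev : ∀ α₀ ∈ T.G i₀, ∀ᶠ m in Filter.atTop, n ≤ cOff a (cdesc T i₀ α₀ m) := by
    intro α₀ hα₀
    rw [Filter.eventually_atTop]
    exact lineage_fat T haa' hlive hLio hRio hα₀
  obtain ⟨M, hM⟩ := Filter.eventually_atTop.mp ((Filter.eventually_all_finset (T.G i₀)).mpr hev)
  obtain ⟨β, hβ, hthin⟩ := T.isolated (i₀ + M) a
  obtain ⟨α₀, hα₀, hdesc⟩ := exists_ancestor' T i₀ M β hβ
  have h := hM M le_rfl α₀ hα₀
  rw [hdesc] at h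
  unfold cOff at h
  omega

/-- **TRIPLY THIN DESCENT (PROVED):** with live directions `lab 0, lab 1, lab 2` from `i₀`, no generator is thin
off all three. [folklore] -/
theorem no_triply_thin' {i₀ : ℕ} (lab : Fin 3 → Fin d) (hlive : ∀ i, i₀ ≤ i → ∃ x, T.dir i = lab x) :
    ∀ M i : ℕ, i₀ ≤ i → ∀ α ∈ T.G i, (∀ x, cOff (lab x) α < n) → α.deg ≤ M → False := by
  have hcu : ∀ i, i₀ ≤ i → ∀ α : Expo d, (∀ x, cOff (lab x) α < n) → cOff (T.dir i) α < n := by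
    intro i hi α h
    obtain ⟨x, hx⟩ := hlive i hi
    rw [hx]
    exact h x
  have himg : ∀ i, i₀ ≤ i → ∀ α ∈ T.G i, (∀ x, cOff (lab x) α < n) →
      ∀ x, cOff (lab x) (Expo.chart n (T.dir i) α) < n := by
    intro i hi α hα h x
    have hdeg := (T.hasOrder i).2 α hα
    by_cases hxd : lab x = T.dir i
    · rw [hxd, cOff_chart_self]
      exact hcu i hi α h
    · have e := cOff_chart_of_ne n hxd α hdeg
      have := hcu i hi α h
      have := h x
      omega
  intro M
  induction M with
  | zero =>
    intro i hi α hα h hM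
    have := (T.hasOrder i).2 α hα
    have := h 0
    omega
  | succ M ih =>
    intro i hi α hα h hM
    have hdeg := (T.hasOrder i).2 α hα
    have hmem := T.chart_mem hα
    have e3 := deg_chart_add n (T.dir i) α hdeg
    have hcu' := hcu i hi α h
    exact ih (i + 1) (by omega) _ hmem (himg i hi α hα h) (by omega)

/-- **LINEAGE FATTENING IN EVERY LIVE DIRECTION (PROVED):** three recurring live directions fatten every lineage
off each of them (the three-letter dynamics `dyn3_eventually`, fed by `no_triply_thin'`). [folklore] -/
theorem lineage_fat3 {i₀ : ℕ} (lab : Fin 3 → Fin d) (hinj : Function.Injective lab)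
    (hlive : ∀ i, i₀ ≤ i → ∃ x, T.dir i = lab x)
    (hrec : ∀ (x : Fin 3) (m : ℕ), ∃ m', m ≤ m' ∧ T.dir (i₀ + m') = lab x)
    {α₀ : Expo d} (hα₀ : α₀ ∈ T.G i₀) :
    ∃ m₀, ∀ m, m₀ ≤ m → ∀ x : Fin 3, n ≤ cOff (lab x) (cdesc T i₀ α₀ m) := by
  classical
  choose wl hwl using (fun m => hlive (i₀ + m) (by omega))
  let yv : ℕ → Fin 3 → ℤ := fun m x => (cOff (lab x) (cdesc T i₀ α₀ m) : ℤ) - n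
  have halive := cdesc_mem T hα₀
  have hdeg : ∀ m, n ≤ (cdesc T i₀ α₀ m).deg := fun m => (T.hasOrder _).2 _ (halive m)
  have hstep : ∀ m x, yv (m + 1) x = if x = wl m then yv m x else yv m x + yv m (wl m) := by
    intro m x
    have hd : cdesc T i₀ α₀ (m + 1) = Expo.chart n (T.dir (i₀ + m)) (cdesc T i₀ α₀ m) := rfl
    split_ifs with hx
    · simp only [yv, hd, hx, hwl m, cOff_chart_self]
    · have hne : lab x ≠ T.dir (i₀ + m) := by
        rw [hwl m]
        exact fun h => hx (hinj h)
      have e := cOff_chart_of_ne n hne (cdesc T i₀ α₀ m) (hdeg m)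
      simp only [yv, hd]
      rw [hwl m] at e ⊢
      omega
  have halive' : ∀ m, ∃ x, 0 ≤ yv m x := by
    intro m
    by_contra h
    push Not at h
    exact no_triply_thin' T lab hlive _ (i₀ + m) (by omega) _ (halive m)
      (fun x => by have := h x; simp only [yv] at this; omega) le_rfl
  have hrec' : ∀ x m, ∃ m', m ≤ m' ∧ wl m' = x := by
    intro x m
    obtain ⟨m', hm', hdm⟩ := hrec x m
    refine ⟨m', hm', hinj ?_⟩
    rw [← hwl m']
    exact hdm
  obtain ⟨m₀, hm₀⟩ := dyn3_eventually hstep halive' hrec'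
  refine ⟨m₀, fun m hm x => ?_⟩
  have := hm₀ m hm x
  simp only [yv] at this
  omega

/-- **THREE RECURRING LIVE DIRECTIONS (PROVED):** pigeonhole over `G i₀` + lineage fattening contradict
`isolated`. [folklore] -/
theorem not_three_live {i₀ : ℕ} (lab : Fin 3 → Fin d) (hinj : Function.Injective lab)
    (hlive : ∀ i, i₀ ≤ i → ∃ x, T.dir i = lab x)
    (hrec : ∀ (x : Fin 3) (m : ℕ), ∃ m', m ≤ m' ∧ T.dir (i₀ + m') = lab x) : False := by
  classical
  have hev : ∀ α₀ ∈ T.G i₀, ∀ᶠ m in Filter.atTop, n ≤ cOff (lab 0) (cdesc T i₀ α₀ m) := by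
    intro α₀ hα₀
    rw [Filter.eventually_atTop]
    obtain ⟨m₀, hm₀⟩ := lineage_fat3 T lab hinj hlive hrec hα₀
    exact ⟨m₀, fun m hm => hm₀ m hm 0⟩
  obtain ⟨M, hM⟩ := Filter.eventually_atTop.mp ((Filter.eventually_all_finset (T.G i₀)).mpr hev)
  obtain ⟨β, hβ, hthin⟩ := T.isolated (i₀ + M) (lab 0)
  obtain ⟨α₀, hα₀, hdesc⟩ := exists_ancestor' T i₀ M β hβ
  have h := hM M le_rfl α₀ hα₀
  rw [hdesc] at h
  unfold cOff at h
  omega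

/-- A dead direction from an «`∃ m`»-indexed hypothesis. [folklore] -/
theorem dead_from {k : Fin d} {i₀ : ℕ} (h : ∀ m, T.dir (i₀ + m) ≠ k) : ∀ i, i₀ ≤ i → T.dir i ≠ k := by
  intro i hi
  have := h (i - i₀)
  rwa [show i₀ + (i - i₀) = i by omega] at this

end CornerTowerDyn

/-- **`NoCornerTower 4 n` — PROVED** (all `n`): exhaustive ⇒ the tree's kernel; a dead direction `k` (live
directions `k.succAbove z`, `z : Fin 3`): one direction eventually constant ⇒ axis descent; a second direction
eventually dead ⇒ two recurring live directions (`not_two_live`); else all three recur ⇒ the three-letter dynamics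
(`not_three_live`). [folklore] -/
theorem noCornerTower_four (n : ℕ) : NoCornerTower 4 n := by
  intro T
  classical
  rcases Nat.eq_zero_or_pos n with hn | hn
  · obtain ⟨α, -, h⟩ := T.isolated 0 0
    omega
  by_cases hX : T.Exhaustive
  · exact T.not_exhaustive hn hX
  unfold CornerTower.Exhaustive at hX
  push Not at hX
  obtain ⟨k, i₀, hk⟩ := hX
  have hdead := CornerTowerDyn.dead_from T hk
  have hlive : ∀ i, i₀ ≤ i → ∃ z : Fin 3, T.dir i = k.succAbove z := fun i hi => by
    obtain ⟨z, hz⟩ := Fin.exists_succAbove_eq (hdead i hi)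
    exact ⟨z, hz.symm⟩
  by_cases hax : ∃ (i₁ : ℕ) (j : Fin 4), ∀ i, i₁ ≤ i → T.dir i = j
  · obtain ⟨i₁, j, hj⟩ := hax
    exact CornerTowerDyn.not_const T hj
  push Not at hax
  -- recurrence bookkeeping from «no direction is eventually constant»
  have hrec2 : ∀ {i₁ : ℕ} {u v : Fin 4}, u ≠ v → (∀ i, i₁ ≤ i → T.dir i = u ∨ T.dir i = v) →
      ∀ m, ∃ m', m ≤ m' ∧ T.dir (i₁ + m') = u := by
    intro i₁ u v huv hlive' m
    by_contra hnone
    push Not at hnone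
    obtain ⟨i, hi, hdi⟩ := hax (i₁ + m) v
    have hm := hnone (i - (i₁ + m) + m) (by omega)
    rw [show i₁ + (i - (i₁ + m) + m) = i by omega] at hm
    rcases hlive' i (by omega) with h | h
    · exact hm h
    · exact hdi h
  by_cases hdead2 : ∃ (i₁ : ℕ) (z₀ : Fin 3), ∀ i, i₁ ≤ i → T.dir i ≠ k.succAbove z₀
  · -- a second direction is eventually dead: two live directions remain
    obtain ⟨i₁, z₀, hz₀⟩ := hdead2
    obtain ⟨c, c', hc, hc', hcc', hcov⟩ := fin3_pair z₀
    have huv : k.succAbove c ≠ k.succAbove c' := fun h => hcc' (Fin.succAbove_right_injective h)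
    have hlive' : ∀ i, max i₀ i₁ ≤ i → T.dir i = k.succAbove c ∨ T.dir i = k.succAbove c' := by
      intro i hi
      obtain ⟨z, hz⟩ := hlive i (le_trans (le_max_left _ _) hi)
      have hzz : z ≠ z₀ := fun h => hz₀ i (le_trans (le_max_right _ _) hi) (by rw [hz, h])
      rcases hcov z hzz with h | h
      · exact Or.inl (by rw [hz, h])
      · exact Or.inr (by rw [hz, h])
    exact CornerTowerDyn.not_two_live T huv hlive' (hrec2 huv hlive')
      (hrec2 (Ne.symm huv) fun i hi => (hlive' i hi).symm)
  · -- all three live directions recur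
    push Not at hdead2
    refine CornerTowerDyn.not_three_live T k.succAbove Fin.succAbove_right_injective hlive fun z m => ?_
    obtain ⟨i, hi, hdi⟩ := hdead2 (i₀ + m) z
    exact ⟨i - i₀, by omega, by rw [show i₀ + (i - i₀) = i by omega]; exact hdi⟩

/-- lens-4's piece `HugDimensionClasses.NoCornerTowers` («KNOWN-MOD-PORT via `CornerModel` + `TowerObstructs`;
ATTACKABLE directly = cheap theorem #17′», MaxContactCut aside 31569) — **PROVED BY NAME, port-free**: `d ≤ 3` is
`CornerTowerDescent.noCornerTower_le_three` (lens-5 g13, two-letter descent), `d = 4` is `noCornerTower_four` (the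
three-letter dynamics), glued by the landed bookkeeping `CornerTowerDescent.noCornerTower_le_four_of_four`.
[DECIDED — PROVED here] (Sources: BierstoneGrigorievMilmanWlodarczyk2011, §3.) -/
theorem noCornerTowers_tree : HugDimensionClasses.NoCornerTowers :=
  CornerTowerDescent.noCornerTower_le_four_of_four fun n _ => noCornerTower_four n

end CornerTowers

end Summit.ResolutionOfSingularities.ResolutionOfSingularities.Theorems.CornerTowerDynamics
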